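import Summits.ValiantsHypothesis.ValiantsHypothesis.Theorems.TwoProducts.MatrixDesnanotJacobi
import Literature.LinearAlgebra.Matrix.WronskianDerivation

/-!
# The SYLVESTER (Frobenius) identity for Wronskians of a derivation: `W(f⃗,g,h) · W(f⃗) = W(f⃗,g) · D W(f⃗,h) − D W(f⃗,g) · W(f⃗,h)`

Wronskians are the tree's ✓ `Literature.LinearAlgebra.Matrix.wronskian (⇑D) f = det (D^[i] (f j))_{i,j}` (ROW = order, COLUMN = function;
`Literature/LinearAlgebra/Matrix/WronskianDerivation.lean`, with `iterate_map_add/zero/sum`, `wronskian_update_sum`, ✓ `wronskian_smul_derivation`) — nothing restated.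
This file adds, for a derivation `D : Derivation R S S` of a commutative `R`-algebra `S`:
the SHIFTED Wronskian
matrix `shiftedMatrix` (last row one order up) with ★ `derivation_wronskian : D (wronskian ⇑D f) = det (shiftedMatrix D f)`, the five minors of the `(n+2)`-Wronskian
matrix of `(f⃗, g, h)`, and — from ✓ `desnanot_jacobi` (`…MatrixDesnanotJacobi`, the `Fin (n+2)`/`succAbove` form of the tree's ✓
`Literature.LinearAlgebra.Matrix.det_mul_det_submatrix_compl_pair`) —
★★ `wronskian_sylvester : wronskian ⇑D (snoc (snoc f g) h) * wronskian ⇑D f = wronskian ⇑D (snoc f g) * D (wronskian ⇑D (snoc f h)) - D (wronskian ⇑D (snoc f g)) * wronskian ⇑D (snoc f h)`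
(Frobenius / Sylvester; G. Frobenius, J. reine angew. Math. 77 (1874) 245–257; G. Pólya, Trans. AMS 24 (1922); e.g. Bostan–Dumas, Amer. Math. Monthly 117 (2010) 722–727 §2
[cite: BostanDumas2010]).  The ℝ-ANALYTIC `deriv` INSTANCE of this identity is already ✓
`Literature.Computability.AlgebraicComplexity.KoiranPortierTavenas2015.WronskianZeroBoundsRefined.wronskian_frobenius` (KPT 2015 Lemma 21, `ℕ → ℝ → ℝ` Wronskians, proved by the
identity principle; val-lit t14); here it is proved in the RING-DERIVATION currency (any `Derivation R S S`, `Fin n → S`) via Desnanot–Jacobi — novelty KNOWN, new to the tree only in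
this currency (lit g19 LOCATOR 6, crit-8 g5 #93′).
§2 (Leibniz over `Finset.prod`, `D (det M)` by columns / rows) consists of PRIVATE copies of the tree's ✓ `Literature.AlgebraicGeometry.Motives.FrobeniusTrace.derivation_prod` /
`…FrobeniusTrace.derivation_det` (column form, identical statement; `Literature/AlgebraicGeometry/Motives/FrobeniusTraceProofs.lean`) and ✓
`Literature.Computability.AlgebraicComplexity.VonZurGathen.derivation_det` (row form; `…/VonZurGathenRegularity.lean`), kept private and unexported to keep this file's import
cone at Mathlib + `…MatrixDesnanotJacobi` + `…WronskianDerivation` (the precedent of `FrobeniusTraceProofs.lean`, design notes) — cite those, not §2 (crit-8 g5 #89 (β2)).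
NOT in the tree before this file (crit-8 #89 (α)): the derivative of an `n × n` derivation-Wronskian and its Sylvester/Frobenius identity — the tree's
`Literature/LinearAlgebra/Matrix/SylvesterDeterminantIdentity.lean :: det_borderedMinors_submatrix_mul_det` is SYLVESTER'S DETERMINANT identity (bordered minors) and
`…JacobiAdjugateMinors.det_mul_det_adjugate_submatrix` is Jacobi on adjugate minors, both different theorems.
PURPOSE: engine of the KPT15-type Wronskian ladder T1-E′ (val-port-1 g5) and of the OLM column route (K∞)/(TW-count) (val-port-4 g5, crit-8 g5 #85/#87) on the SIDE ladder
«table-rank-ladder» of crux `stmt-ValiantsHypothesis-5906` (`TwoProducts`), with `D = M • jacDer v` on `ℂ[x,y]`.  HONEST LABEL: pure algebra; nothing here is about 5906 /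
`PlanarCellBound` / `ResidualLawV25`; VP ≠ VNP is NOT proved here or anywhere in this tree.  `--supports stmt-ValiantsHypothesis-5906 --as helper`.
No instances, no notation, no named facts. [folklore]
-/

set_option linter.dupNamespace false

namespace Summit.ValiantsHypothesis.ValiantsHypothesis.Theorems.TwoProducts.Wronskian

open Matrix
open Summit.ValiantsHypothesis.ValiantsHypothesis.Theorems.TwoProducts.DesnanotJacobi
open Literature.LinearAlgebra.Matrix (wronskianMatrix wronskian wronskianMatrix_apply wronskian_def)

variable {R S : Type*} [CommRing R] [CommRing S] [Algebra R S] (D : Derivation R S S)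

/-! ### §1 The shifted Wronskian matrix -/

/-- The SHIFTED Wronskian matrix of `f : Fin (m+1) → S`: the last ROW carries `D^[m+1]` instead of `D^[m]` (rows = orders, columns = functions, as in
✓ `Literature.LinearAlgebra.Matrix.wronskianMatrix`). -/
def shiftedMatrix {m : ℕ} (f : Fin (m + 1) → S) : Matrix (Fin (m + 1)) (Fin (m + 1)) S :=
  Matrix.of fun i j => (⇑D)^[if i = Fin.last m then m + 1 else (i : ℕ)] (f j)

/-! ### §2 Leibniz for products and determinants (PRIVATE copies of landed Literature lemmas — cite those) -/

/-- Leibniz for `Finset.prod`: `D (Π_{i∈s} a i) = Σ_{i∈s} (Π_{j∈s∖i} a j) · D (a i)`.  PRIVATE copy: restates ✓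
`Literature.AlgebraicGeometry.Motives.FrobeniusTrace.derivation_prod` (identical) / ✓ `Literature.Computability.AlgebraicComplexity.VonZurGathen.derivation_prod`; kept private
to keep the TwoProducts import cone small (cite the Literature decls, not this). [folklore] -/
private theorem derivation_prod {ι : Type*} [DecidableEq ι] (s : Finset ι) (a : ι → S) :
    D (∏ i ∈ s, a i) = ∑ i ∈ s, (∏ j ∈ s.erase i, a j) * D (a i) := by
  induction s using Finset.induction_on with
  | empty => simp
  | @insert k s hk ih =>
    rw [Finset.prod_insert hk, Derivation.leibniz, smul_eq_mul, smul_eq_mul, ih, Finset.sum_insert hk, Finset.erase_insert hk,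
      Finset.mul_sum, add_comm]
    congr 1
    refine Finset.sum_congr rfl fun i hi => ?_
    have hki : k ≠ i := fun h => hk (h ▸ hi)
    rw [Finset.erase_insert_of_ne hki, Finset.prod_insert (fun h => hk (Finset.mem_of_mem_erase h))]
    ring

/-- Derivative of a determinant (columns): `D (det M) = Σ_j det (M with column j replaced by its D-derivative)`.  PRIVATE copy: restates ✓
`Literature.AlgebraicGeometry.Motives.FrobeniusTrace.derivation_det` (column form, identical statement); kept private to keep the import cone small (cite that). [folklore] -/
private theorem derivation_det {m : Type*} [Fintype m] [DecidableEq m] (M : Matrix m m S) :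
    D M.det = ∑ j, (M.updateCol j fun i => D (M i j)).det := by
  have hcol : ∀ j, (M.updateCol j fun i => D (M i j)).det =
      ∑ σ : Equiv.Perm m, Equiv.Perm.sign σ • ((∏ i ∈ Finset.univ.erase j, M (σ i) i) * D (M (σ j) j)) := by
    intro j
    rw [det_apply]
    refine Finset.sum_congr rfl fun σ _ => ?_
    congr 1
    rw [← Finset.mul_prod_erase Finset.univ _ (Finset.mem_univ j), updateCol_self, mul_comm]
    congr 1
    refine Finset.prod_congr rfl fun i hi => ?_
    rw [updateCol_ne (Finset.ne_of_mem_erase hi)]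
  simp_rw [hcol]
  rw [det_apply, map_sum D, Finset.sum_comm]
  refine Finset.sum_congr rfl fun σ _ => ?_
  rw [Units.smul_def, map_zsmul, derivation_prod, Finset.smul_sum]
  refine Finset.sum_congr rfl fun j _ => ?_
  rw [Units.smul_def]

/-- Derivative of a determinant (rows): `D (det M) = Σ_i det (M with row i replaced by its D-derivative)`.  PRIVATE copy: restates ✓
`Literature.Computability.AlgebraicComplexity.VonZurGathen.derivation_det` (row form); derived here from the column form by `det_transpose` (cite that). [folklore] -/
private theorem derivation_det_row {m : Type*} [Fintype m] [DecidableEq m] (M : Matrix m m S) :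
    D M.det = ∑ i, (M.updateRow i fun j => D (M i j)).det := by
  rw [← det_transpose, derivation_det]
  refine Finset.sum_congr rfl fun i _ => ?_
  rw [← det_transpose]
  congr 1
  ext a b
  simp only [transpose_apply, updateCol_apply, updateRow_apply]

/-- ★ **Derivative of a Wronskian:** only the last row survives — `D (W_D f) = det (shiftedMatrix D f)`. [folklore] -/
theorem derivation_wronskian {m : ℕ} (f : Fin (m + 1) → S) : D (wronskian (⇑D) f) = (shiftedMatrix D f).det := by
  rw [wronskian_def, derivation_det_row, Fintype.sum_eq_single (Fin.last m)]
  · congr 1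
    ext i j
    simp only [wronskianMatrix_apply, shiftedMatrix, updateRow_apply, Matrix.of_apply]
    by_cases hi : i = Fin.last m
    · rw [if_pos hi, if_pos hi]
      subst hi
      rw [Fin.val_last, ← Function.iterate_succ_apply' (⇑D) m]
    · rw [if_neg hi, if_neg hi]
  · intro i hi
    -- rows `i` (differentiated) and `i + 1` coincide
    have hilt : (i : ℕ) < m := Fin.val_lt_last hi
    apply det_zero_of_row_eq (i := i) (j := ⟨(i : ℕ) + 1, by omega⟩)
    · intro h
      have := congrArg Fin.val h
      simp at this
    · funext k
      simp only [wronskianMatrix_apply, updateRow_apply, if_true]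
      rw [if_neg (by intro h; have := congrArg Fin.val h; simp at this), ← Function.iterate_succ_apply' (⇑D)]

/-! ### §3 The `(n+2)`-Wronskian matrix of `(f⃗, g, h)` and its five minors -/

/-- Entries of `snoc (snoc f g) h` at the interior positions. [folklore] -/
theorem snoc_snoc_castSucc_castSucc {α : Type*} {n : ℕ} (f : Fin n → α) (g h : α) (k : Fin n) :
    (Fin.snoc (Fin.snoc f g : Fin (n + 1) → α) h : Fin (n + 2) → α) k.castSucc.castSucc = f k := by
  rw [Fin.snoc_castSucc, Fin.snoc_castSucc]

/-- `b.succAbove` (`b = (last n).castSucc`) in coordinates: skip `n`. [folklore] -/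
theorem val_succAbove_b {n : ℕ} (j : Fin (n + 1)) :
    (((Fin.last n).castSucc : Fin (n + 2)).succAbove j : ℕ) = if j = Fin.last n then n + 1 else (j : ℕ) := by
  by_cases hj : j = Fin.last n
  · rw [if_pos hj, hj, Fin.succAbove_of_le_castSucc _ _ le_rfl]
    simp
  · rw [if_neg hj, Fin.succAbove_of_castSucc_lt]
    · simp
    · exact Fin.castSucc_lt_castSucc_iff.mpr (Fin.lt_last_iff_ne_last.mpr hj)

/-- Entries along `b.succAbove`: `(f⃗, h)`. [folklore] -/
theorem snoc_snoc_succAbove_b {α : Type*} {n : ℕ} (f : Fin n → α) (g h : α) (i : Fin (n + 1)) :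
    (Fin.snoc (Fin.snoc f g : Fin (n + 1) → α) h : Fin (n + 2) → α) (((Fin.last n).castSucc : Fin (n + 2)).succAbove i) =
      (Fin.snoc f h : Fin (n + 1) → α) i := by
  by_cases hi : i = Fin.last n
  · rw [hi, Fin.succAbove_of_le_castSucc _ _ le_rfl, Fin.snoc_last]
    have : (Fin.last n).succ = Fin.last (n + 1) := by ext; simp
    rw [this, Fin.snoc_last]
  · have hlt : i.castSucc < (Fin.last n).castSucc := Fin.castSucc_lt_castSucc_iff.mpr (Fin.lt_last_iff_ne_last.mpr hi)
    rw [Fin.succAbove_of_castSucc_lt _ _ hlt]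
    obtain ⟨k, rfl⟩ : ∃ k : Fin n, k.castSucc = i := ⟨i.castPred hi, Fin.castSucc_castPred i hi⟩
    rw [snoc_snoc_castSucc_castSucc, Fin.snoc_castSucc]

section minors
variable {n : ℕ} (f : Fin n → S) (g h : S)

/-- Minor `A_a^a` (delete order `n+1`, function `h`) = Wronskian matrix of `(f⃗, g)`. [folklore] -/
theorem minor_aa : (wronskianMatrix (⇑D) (Fin.snoc (Fin.snoc f g : Fin (n + 1) → S) h)).submatrix (Fin.last (n + 1)).succAbove (Fin.last (n + 1)).succAbove =
    wronskianMatrix (⇑D) (Fin.snoc f g) := by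
  ext i j
  simp only [submatrix_apply, wronskianMatrix_apply, Fin.succAbove_last, Fin.val_castSucc, Fin.snoc_castSucc]

/-- Minor `A_a^b` (delete order `n+1`, function `g`) = Wronskian matrix of `(f⃗, h)`. [folklore] -/
theorem minor_ab : (wronskianMatrix (⇑D) (Fin.snoc (Fin.snoc f g : Fin (n + 1) → S) h)).submatrix
      (Fin.last (n + 1)).succAbove ((Fin.last n).castSucc : Fin (n + 2)).succAbove = wronskianMatrix (⇑D) (Fin.snoc f h) := by
  ext i j
  simp only [submatrix_apply, wronskianMatrix_apply, Fin.succAbove_last, Fin.val_castSucc, snoc_snoc_succAbove_b]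

/-- Minor `A_b^b` (delete order `n`, function `g`) = SHIFTED Wronskian matrix of `(f⃗, h)`. [folklore] -/
theorem minor_bb : (wronskianMatrix (⇑D) (Fin.snoc (Fin.snoc f g : Fin (n + 1) → S) h)).submatrix
      ((Fin.last n).castSucc : Fin (n + 2)).succAbove ((Fin.last n).castSucc : Fin (n + 2)).succAbove = shiftedMatrix D (Fin.snoc f h) := by
  ext i j
  simp only [submatrix_apply, wronskianMatrix_apply, shiftedMatrix, Matrix.of_apply, snoc_snoc_succAbove_b, val_succAbove_b]

/-- Minor `A_b^a` (delete order `n`, function `h`) = SHIFTED Wronskian matrix of `(f⃗, g)`. [folklore] -/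
theorem minor_ba : (wronskianMatrix (⇑D) (Fin.snoc (Fin.snoc f g : Fin (n + 1) → S) h)).submatrix
      ((Fin.last n).castSucc : Fin (n + 2)).succAbove (Fin.last (n + 1)).succAbove = shiftedMatrix D (Fin.snoc f g) := by
  ext i j
  simp only [submatrix_apply, wronskianMatrix_apply, shiftedMatrix, Matrix.of_apply, Fin.succAbove_last, Fin.snoc_castSucc, val_succAbove_b]

/-- Interior minor = Wronskian matrix of `f⃗`. [folklore] -/
theorem minor_interior : (wronskianMatrix (⇑D) (Fin.snoc (Fin.snoc f g : Fin (n + 1) → S) h)).submatrix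
      (Fin.castSucc ∘ Fin.castSucc) (Fin.castSucc ∘ Fin.castSucc) = wronskianMatrix (⇑D) f := by
  ext i j
  simp only [submatrix_apply, wronskianMatrix_apply, Function.comp_apply, Fin.val_castSucc, snoc_snoc_castSucc_castSucc]

end minors

/-! ### §4 Sylvester's identity for Wronskians -/

/-- ★★ **SYLVESTER'S (FROBENIUS') IDENTITY FOR WRONSKIANS:** `W(f⃗,g,h) · W(f⃗) = W(f⃗,g) · D W(f⃗,h) − D W(f⃗,g) · W(f⃗,h)`, i.e.
`W_D(W(f⃗,g), W(f⃗,h)) = W(f⃗) · W(f⃗,g,h)` (✓ `desnanot_jacobi` on the `(n+2)`-Wronskian matrix of `(f⃗, g, h)` + `derivation_wronskian`), for an ARBITRARY derivation;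
the ℝ-analytic `deriv` instance is ✓ `…KoiranPortierTavenas2015.WronskianZeroBoundsRefined.wronskian_frobenius` (KPT 2015 Lemma 21; Frobenius 1874, Pólya 1922). -/
theorem wronskian_sylvester {n : ℕ} (f : Fin n → S) (g h : S) :
    wronskian (⇑D) (Fin.snoc (Fin.snoc f g : Fin (n + 1) → S) h) * wronskian (⇑D) f =
      wronskian (⇑D) (Fin.snoc f g) * D (wronskian (⇑D) (Fin.snoc f h)) - D (wronskian (⇑D) (Fin.snoc f g)) * wronskian (⇑D) (Fin.snoc f h) := by
  have hdj := desnanot_jacobi (wronskianMatrix (⇑D) (Fin.snoc (Fin.snoc f g : Fin (n + 1) → S) h))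
  rw [minor_aa, minor_bb, minor_ab, minor_ba, minor_interior] at hdj
  rw [derivation_wronskian, derivation_wronskian]
  simp only [wronskian_def]
  rw [hdj]
  ring

end Summit.ValiantsHypothesis.ValiantsHypothesis.Theorems.TwoProducts.Wronskian
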